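import Summits.BirchSwinnertonDyer.BirchSwinnertonDyer.Theorems.ManinLocalTwoThreeKummerDiamondStepTwoKummerSubgroup
import Literature.NumberTheory.EllipticCurves.ModularSymbolsManinDrinfeldGeneralProofs
import HarnessLib

/-!
# The CONCRETE Kummer subgroup `𝒱` of `StepTwo.propositionA_complex`: `T = ⟨R_y (y unitary), W₀[2]⟩` is a finite group of rational
# torsion points (Manin–Drinfeld), so the Kummer classes of its halves form `𝒱` with `Nat.card 𝒱 ≤ 4`
(route `ManinLocalTwoThree`, crux C2 `ManinOddAtFour` stmt-BirchSwinnertonDyer-22967; cell bsd-f2-manin, C2/C3 LEAD p1 gen 20;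
`--supports stmt-BirchSwinnertonDyer-22967`; line card `Cruxes/ManinOddAtFour/Lines/kummer_diamond.md`, node D6 input «𝒱» of
p2's `StepTwo.propositionA_complex` (p761682): its binders `𝒱`, `h𝒱fin`, `h𝒱`, and the MEMBERSHIP half of `hKum` / `hodd`)

p2's abstract `StepTwo.exists_kummerSubgroup` (p761785-series, `…KummerDiamondStepTwoKummerSubgroup`) produces `𝒱` from a FINITE subgroup
`T ≤ W₀(ℂ)` of points fixed by `Aut(ℂ/ℚ)` containing `W₀(ℂ)[2]`.  This file supplies that `T` CONCRETELY and packages the result in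
the shape the instantiation needs:

* §1 `isOfFinAddOrder_uniformize_mul_modularSymbol` — the cusp points `π₀(c₀·{∞, r}_f)` (`r ∈ ℚ`), in particular the
  Atkin–Lehner points `R_y = π₀(c₀·{∞, 1/y}_f)`, are TORSION: Manin–Drinfeld is a tree THEOREM
  (`exists_nsmul_modularSymbol_mem_periodLattice_holds`) and `c₀Λ₀(f) ⊆ Λ_{W₀}` (`smul_periodLattice_le`).
* §2 `exists_kummerSubgroup_baseChange` — for ANY finite set `F ⊆ W₀(ℂ)` of rational torsion points, with all of `W₀(ℂ)[2]`
  rational (D1, E-an-152d): `T := ⟨F ∪ W₀[2]⟩` is finitely generated and torsion, hence finite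
  (`AddCommGroup.finite_of_fg_torsion`), pointwise fixed (`Affine.Point.map_baseChange` + `closure_induction`), so p2's lemma gives
  `𝒱` with `(𝒱 : Set _).Finite`, `Nat.card 𝒱 ≤ 4` and `(σ ↦ σS − S) ∈ 𝒱` whenever `2S ∈ F` or `2S ∈ W₀[2]`.
* §3 `exists_kummerSubgroup_cuspHalves` — the instantiation `F = {R_y : N = Q·y coprime}`: given D1 (all `2`-torsion rational)
  and D3 (each `R_y` rational — `KummerDiamond.uniformize_modularSymbol_inv_unitary_rational`, p760693, ⟸ the printed X₀ cusp
  fact), there is ONE `𝒱` (finite, `Nat.card ≤ 4`) containing the Kummer class of `S_y = π₀(c₀·{∞,1/y}_f/2)` for EVERY coprime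
  splitting `N = Q·y` (the `f` of `hKum`; its VALUES are es g39's `indexFour_kummerDiamondReciprocity`) and of every half of a
  `2`-torsion point (the odd class of `hodd`).

UNCONDITIONAL (the printed facts enter only through the HYPOTHESES `h2rat` / `hRrat` at instantiation); no definitions (existence
statements only), no sorry.  Nothing about E-es-185, C2, Manin's conjecture or BSD is proved here.
[cite: SilvermanAEC2009, Prop. X.1.4 and proof of Thm. X.1.1 (the Kummer pairing `E(K)/2E(K) → H¹`)] [cite: Manin1972, Cor. 3.6]
-/

set_option autoImplicit false
-- lint-debt: the directory name repeats the summit name (sibling precedent `ManinLocalTwoThreeKummerDiamondStepTwoKummerSubgroup.lean`)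
set_option linter.dupNamespace false

noncomputable section

open WeierstrassCurve Literature.NumberTheory.EllipticCurves Literature.NumberTheory.EllipticCurves.ModularForms

namespace Summit.BirchSwinnertonDyer.BirchSwinnertonDyer.Theorems.ManinLocalTwoThree.KummerSubgroup

variable {W₀ : WeierstrassCurve ℚ} {N : ℕ} [NeZero N]

/-! ## §1 Torsion of the cusp points (Manin–Drinfeld) -/

/-- **The cusp points `π₀(c₀·{∞, r}_f)` are torsion** (`r ∈ ℚ`): by the Manin–Drinfeld theorem (tree theorem
`exists_nsmul_modularSymbol_mem_periodLattice_holds`: `n·{∞, r}_f ∈ Λ₀(f)` for some `n ≥ 1`) and `c₀Λ₀(f) ⊆ Λ_{W₀}`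
(`smul_periodLattice_le`).  In particular the Atkin–Lehner points `R_Q = π₀(c₀·{∞, 1/y}_f)` are torsion.
[cite: Manin1972, Cor. 3.6] -/
theorem isOfFinAddOrder_uniformize_mul_modularSymbol (D₀ : ModularParametrizationData W₀ N) (r : ℚ) :
    IsOfFinAddOrder (D₀.uniformize ((D₀.c : ℂ) * modularSymbol D₀.f r)) := by
  obtain ⟨n, hn, hmem⟩ := exists_nsmul_modularSymbol_mem_periodLattice_holds D₀.f r
  rw [isOfFinAddOrder_iff_nsmul_eq_zero]
  refine ⟨n, hn, ?_⟩
  rw [← map_nsmul, D₀.uniformize_eq_zero_iff, nsmul_eq_mul, show (n : ℂ) * ((D₀.c : ℂ) * modularSymbol D₀.f r) =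
    (D₀.c : ℂ) * (n • modularSymbol D₀.f r) by rw [nsmul_eq_mul]; ring]
  exact D₀.smul_periodLattice_le _ hmem

/-! ## §2 The Kummer subgroup of `⟨F ∪ W₀[2]⟩` for a finite set `F` of rational torsion points -/

/-- **The Kummer subgroup `𝒱` for `StepTwo.propositionA_complex`.**  Let `W₀/ℚ` carry a modular parametrisation datum `D₀` (only
used for `|W₀(ℂ)[2]| ≤ 4`, p2 `StepTwo.natCard_ker_two_le_four`), let `F ⊆ W₀(ℂ)` be a finite set of RATIONAL TORSION points, and
suppose every `2`-torsion point of `W₀(ℂ)` is rational (D1, E-an-152d).  Then there is a finite subgroup `𝒱` of functions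
`(ℂ ≃ₐ[ℚ] ℂ) → W₀(ℂ)` with `Nat.card 𝒱 ≤ 4` containing the Kummer cocycle `σ ↦ σS − S` of every `S` with `2S ∈ F` or `2S ∈ W₀[2]`.
Proof: p2's `StepTwo.exists_kummerSubgroup` with `T = ⟨F ∪ W₀[2]⟩` (finite: finitely generated and torsion; pointwise fixed:
`Affine.Point.map_baseChange`). [cite: SilvermanAEC2009, Prop. X.1.4 and proof of Thm. X.1.1] -/
theorem exists_kummerSubgroup_baseChange (D₀ : ModularParametrizationData W₀ N)
    (F : Set (W₀.baseChange ℂ).toAffine.Point) (hF : F.Finite)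
    (hFrat : ∀ P ∈ F, ∃ P₀ : (W₀.baseChange ℚ).toAffine.Point, Affine.Point.baseChange (W' := W₀) ℚ ℂ P₀ = P)
    (hFtor : ∀ P ∈ F, IsOfFinAddOrder P)
    (h2rat : ∀ P : (W₀.baseChange ℂ).toAffine.Point, 2 • P = 0 →
      ∃ P₀ : (W₀.baseChange ℚ).toAffine.Point, Affine.Point.baseChange (W' := W₀) ℚ ℂ P₀ = P) :
    ∃ 𝒱 : AddSubgroup ((ℂ ≃ₐ[ℚ] ℂ) → (W₀.baseChange ℂ).toAffine.Point),
      (𝒱 : Set ((ℂ ≃ₐ[ℚ] ℂ) → (W₀.baseChange ℂ).toAffine.Point)).Finite ∧ Nat.card 𝒱 ≤ 4 ∧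
      ∀ S : (W₀.baseChange ℂ).toAffine.Point, (2 • S ∈ F ∨ 2 • (2 • S) = 0) →
        (fun σ : ℂ ≃ₐ[ℚ] ℂ ↦ Affine.Point.map (W' := W₀) (σ : ℂ →ₐ[ℚ] ℂ) S - S) ∈ 𝒱 := by
  classical
  set V2 : Set (W₀.baseChange ℂ).toAffine.Point := {P | 2 • P = 0} with hV2
  have hV2fin : V2.Finite := (StepTwo.ncard_twoTorsion_le_four D₀).1
  -- the finite torsion subgroup `T = ⟨F ∪ W₀[2]⟩`
  let T : AddSubgroup (W₀.baseChange ℂ).toAffine.Point := AddSubgroup.closure (F ∪ V2)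
  haveI : Finite (F ∪ V2 : Set _) := (hF.union hV2fin).to_subtype
  haveI : AddGroup.FG T := AddGroup.closure_finite_fg _
  have htors : AddMonoid.IsTorsion T := by
    intro x
    have hx : IsOfFinAddOrder (x : (W₀.baseChange ℂ).toAffine.Point) := by
      have hle : T ≤ AddCommGroup.torsion (W₀.baseChange ℂ).toAffine.Point := by
        refine (AddSubgroup.closure_le (K := AddCommGroup.torsion _)).mpr ?_
        rintro P (hP | hP)
        · exact hFtor P hP
        · exact isOfFinAddOrder_iff_nsmul_eq_zero.mpr ⟨2, two_pos, hP⟩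
      exact hle x.2
    exact (T.subtype_injective.isOfFinAddOrder_iff).mp hx
  haveI : Finite T := AddCommGroup.finite_of_fg_torsion _ htors
  -- pointwise fixed by `Aut(ℂ/ℚ)`
  have hfix : ∀ σ : ℂ ≃ₐ[ℚ] ℂ, ∀ P ∈ T, Affine.Point.map (W' := W₀) (σ : ℂ →ₐ[ℚ] ℂ) P = P := by
    intro σ P hP
    replace hP : P ∈ AddSubgroup.closure (F ∪ V2) := hP
    induction hP using AddSubgroup.closure_induction with
    | mem P hP =>
      obtain ⟨P₀, rfl⟩ : ∃ P₀ : (W₀.baseChange ℚ).toAffine.Point, Affine.Point.baseChange (W' := W₀) ℚ ℂ P₀ = P := by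
        rcases hP with hP | hP
        · exact hFrat P hP
        · exact h2rat P hP
      exact Affine.Point.map_baseChange (W' := W₀) (σ : ℂ →ₐ[ℚ] ℂ) P₀
    | zero => exact map_zero _
    | add P Q _ _ hP hQ => rw [map_add, hP, hQ]
    | neg P _ hP => rw [map_neg, hP]
  have h2 : ∀ P : (W₀.baseChange ℂ).toAffine.Point, 2 • P = 0 → P ∈ T := fun P hP ↦
    AddSubgroup.subset_closure (Or.inr hP)
  obtain ⟨𝒱, h𝒱fin, h𝒱card, h𝒱mem⟩ :=
    StepTwo.exists_kummerSubgroup (fun σ : ℂ ≃ₐ[ℚ] ℂ ↦ Affine.Point.map (W' := W₀) (σ : ℂ →ₐ[ℚ] ℂ)) T hfix h2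
      (StepTwo.natCard_ker_two_le_four D₀ T)
  refine ⟨𝒱, h𝒱fin, h𝒱card, fun S hS ↦ h𝒱mem S ?_⟩
  rcases hS with hS | hS
  · exact AddSubgroup.subset_closure (Or.inl hS)
  · exact h2 _ hS

/-! ## §3 The instantiation with the Atkin–Lehner points `R_y`, `N = Q·y` coprime -/

/-- **The Kummer subgroup of the cusp halves.**  For an `X₀(N)`-datum `D₀` of `W₀` such that (D1) every `2`-torsion point of
`W₀(ℂ)` is rational and (D3) the Atkin–Lehner point `R_y = π₀(c₀·{∞, 1/y}_f)` is rational for every coprime splitting `N = Q·y`,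
there is a finite subgroup `𝒱` of functions `(ℂ ≃ₐ[ℚ] ℂ) → W₀(ℂ)` with `Nat.card 𝒱 ≤ 4` containing the Kummer class
`σ ↦ σ(S_y) − S_y` of the half `S_y = π₀(c₀·{∞, 1/y}_f / 2)` for EVERY coprime splitting `N = Q·y` (the `f` of `hKum` in
`StepTwo.propositionA_complex`, whose values are THEOREM K = `KummerDiamond.indexFour_kummerDiamondReciprocity`) and the Kummer
class of every half of a `2`-torsion point (the odd class of `hodd`).  (`R_y` is torsion by Manin–Drinfeld, §1.)
[cite: SilvermanAEC2009, Prop. X.1.4 and proof of Thm. X.1.1] [cite: Manin1972, Cor. 3.6] -/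
theorem exists_kummerSubgroup_cuspHalves (D₀ : ModularParametrizationData W₀ N)
    (h2rat : ∀ P : (W₀.baseChange ℂ).toAffine.Point, 2 • P = 0 →
      ∃ P₀ : (W₀.baseChange ℚ).toAffine.Point, Affine.Point.baseChange (W' := W₀) ℚ ℂ P₀ = P)
    (hRrat : ∀ Q y : ℕ, Q * y = N → Nat.Coprime Q y →
      ∃ P₀ : (W₀.baseChange ℚ).toAffine.Point,
        Affine.Point.baseChange (W' := W₀) ℚ ℂ P₀ = D₀.uniformize ((D₀.c : ℂ) * modularSymbol D₀.f (1 / (y : ℚ)))) :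
    ∃ 𝒱 : AddSubgroup ((ℂ ≃ₐ[ℚ] ℂ) → (W₀.baseChange ℂ).toAffine.Point),
      (𝒱 : Set ((ℂ ≃ₐ[ℚ] ℂ) → (W₀.baseChange ℂ).toAffine.Point)).Finite ∧ Nat.card 𝒱 ≤ 4 ∧
      (∀ Q y : ℕ, Q * y = N → Nat.Coprime Q y →
        (fun σ : ℂ ≃ₐ[ℚ] ℂ ↦
          Affine.Point.map (W' := W₀) (σ : ℂ →ₐ[ℚ] ℂ) (D₀.uniformize ((D₀.c : ℂ) * modularSymbol D₀.f (1 / (y : ℚ)) / 2)) -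
            D₀.uniformize ((D₀.c : ℂ) * modularSymbol D₀.f (1 / (y : ℚ)) / 2)) ∈ 𝒱) ∧
      (∀ S : (W₀.baseChange ℂ).toAffine.Point, 2 • (2 • S) = 0 →
        (fun σ : ℂ ≃ₐ[ℚ] ℂ ↦ Affine.Point.map (W' := W₀) (σ : ℂ →ₐ[ℚ] ℂ) S - S) ∈ 𝒱) := by
  classical
  have hN0 : N ≠ 0 := NeZero.ne N
  -- the finite set of Atkin–Lehner points
  let R : ℕ → (W₀.baseChange ℂ).toAffine.Point := fun y ↦ D₀.uniformize ((D₀.c : ℂ) * modularSymbol D₀.f (1 / (y : ℚ)))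
  set F : Set (W₀.baseChange ℂ).toAffine.Point := {P | ∃ y : ℕ, y ∣ N ∧ Nat.Coprime (N / y) y ∧ P = R y} with hF
  have hFfin : F.Finite := by
    refine ((Set.finite_le_nat N).image R).subset ?_
    rintro P ⟨y, hy, -, rfl⟩
    exact ⟨y, Nat.le_of_dvd (Nat.pos_of_ne_zero hN0) hy, rfl⟩
  have hFrat : ∀ P ∈ F, ∃ P₀ : (W₀.baseChange ℚ).toAffine.Point, Affine.Point.baseChange (W' := W₀) ℚ ℂ P₀ = P := by
    rintro P ⟨y, hy, hcop, rfl⟩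
    exact hRrat (N / y) y (Nat.div_mul_cancel hy) hcop
  have hFtor : ∀ P ∈ F, IsOfFinAddOrder P := by
    rintro P ⟨y, -, -, rfl⟩
    exact isOfFinAddOrder_uniformize_mul_modularSymbol D₀ _
  obtain ⟨𝒱, h𝒱fin, h𝒱card, h𝒱mem⟩ := exists_kummerSubgroup_baseChange D₀ F hFfin hFrat hFtor h2rat
  refine ⟨𝒱, h𝒱fin, h𝒱card, fun Q y hQy hcop ↦ h𝒱mem _ (Or.inl ?_), fun S hS ↦ h𝒱mem S (Or.inr hS)⟩
  -- `2 • S_y = R_y ∈ F`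
  have hy : y ∣ N := ⟨Q, by rw [mul_comm]; exact hQy.symm⟩
  have hy0 : y ≠ 0 := by rintro rfl; exact hN0 (by rw [← hQy, mul_zero])
  have hQ : N / y = Q := Nat.div_eq_of_eq_mul_left (Nat.pos_of_ne_zero hy0) hQy.symm
  refine ⟨y, hy, by rw [hQ]; exact hcop, ?_⟩
  rw [← map_nsmul]
  congr 1
  rw [nsmul_eq_mul]; push_cast; ring

/-! ## §4 (appended, LEAD p1 gen 20) The same with FIXEDNESS hypotheses instead of rationality -/

/-- **The Kummer subgroup from a finite set of FIXED torsion points.**  As `exists_kummerSubgroup_baseChange`, but with the generators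
`F` and the `2`-torsion of `W₀(ℂ)` only assumed FIXED by every `σ ∈ Aut(ℂ/ℚ)` (rather than rational): `T = ⟨F ∪ W₀[2]⟩` is finite, torsion and
pointwise fixed, so p2's `StepTwo.exists_kummerSubgroup` applies. [cite: SilvermanAEC2009, Prop. X.1.4 and proof of Thm. X.1.1] -/
theorem exists_kummerSubgroup_of_fixed (D₀ : ModularParametrizationData W₀ N)
    (F : Set (W₀.baseChange ℂ).toAffine.Point) (hF : F.Finite)
    (hFfix : ∀ P ∈ F, ∀ σ : ℂ ≃ₐ[ℚ] ℂ, Affine.Point.map (W' := W₀) (σ : ℂ →ₐ[ℚ] ℂ) P = P)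
    (hFtor : ∀ P ∈ F, IsOfFinAddOrder P)
    (h2fix : ∀ P : (W₀.baseChange ℂ).toAffine.Point, 2 • P = 0 → ∀ σ : ℂ ≃ₐ[ℚ] ℂ,
      Affine.Point.map (W' := W₀) (σ : ℂ →ₐ[ℚ] ℂ) P = P) :
    ∃ 𝒱 : AddSubgroup ((ℂ ≃ₐ[ℚ] ℂ) → (W₀.baseChange ℂ).toAffine.Point),
      (𝒱 : Set ((ℂ ≃ₐ[ℚ] ℂ) → (W₀.baseChange ℂ).toAffine.Point)).Finite ∧ Nat.card 𝒱 ≤ 4 ∧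
      ∀ S : (W₀.baseChange ℂ).toAffine.Point, (2 • S ∈ F ∨ 2 • (2 • S) = 0) →
        (fun σ : ℂ ≃ₐ[ℚ] ℂ ↦ Affine.Point.map (W' := W₀) (σ : ℂ →ₐ[ℚ] ℂ) S - S) ∈ 𝒱 := by
  classical
  set V2 : Set (W₀.baseChange ℂ).toAffine.Point := {P | 2 • P = 0} with hV2
  have hV2fin : V2.Finite := (StepTwo.ncard_twoTorsion_le_four D₀).1
  let T : AddSubgroup (W₀.baseChange ℂ).toAffine.Point := AddSubgroup.closure (F ∪ V2)
  haveI : Finite (F ∪ V2 : Set _) := (hF.union hV2fin).to_subtype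
  haveI : AddGroup.FG T := AddGroup.closure_finite_fg _
  have htors : AddMonoid.IsTorsion T := by
    intro x
    have hx : IsOfFinAddOrder (x : (W₀.baseChange ℂ).toAffine.Point) := by
      have hle : T ≤ AddCommGroup.torsion (W₀.baseChange ℂ).toAffine.Point := by
        refine (AddSubgroup.closure_le (K := AddCommGroup.torsion _)).mpr ?_
        rintro P (hP | hP)
        · exact hFtor P hP
        · exact isOfFinAddOrder_iff_nsmul_eq_zero.mpr ⟨2, two_pos, hP⟩
      exact hle x.2
    exact (T.subtype_injective.isOfFinAddOrder_iff).mp hx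
  haveI : Finite T := AddCommGroup.finite_of_fg_torsion _ htors
  have hfix : ∀ σ : ℂ ≃ₐ[ℚ] ℂ, ∀ P ∈ T, Affine.Point.map (W' := W₀) (σ : ℂ →ₐ[ℚ] ℂ) P = P := by
    intro σ P hP
    replace hP : P ∈ AddSubgroup.closure (F ∪ V2) := hP
    induction hP using AddSubgroup.closure_induction with
    | mem P hP =>
      rcases hP with hP | hP
      · exact hFfix P hP σ
      · exact h2fix P hP σ
    | zero => exact map_zero _
    | add P Q _ _ hP hQ => rw [map_add, hP, hQ]
    | neg P _ hP => rw [map_neg, hP]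
  have h2 : ∀ P : (W₀.baseChange ℂ).toAffine.Point, 2 • P = 0 → P ∈ T := fun P hP ↦
    AddSubgroup.subset_closure (Or.inr hP)
  obtain ⟨𝒱, h𝒱fin, h𝒱card, h𝒱mem⟩ :=
    StepTwo.exists_kummerSubgroup (fun σ : ℂ ≃ₐ[ℚ] ℂ ↦ Affine.Point.map (W' := W₀) (σ : ℂ →ₐ[ℚ] ℂ)) T hfix h2
      (StepTwo.natCard_ker_two_le_four D₀ T)
  refine ⟨𝒱, h𝒱fin, h𝒱card, fun S hS ↦ h𝒱mem S ?_⟩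
  rcases hS with hS | hS
  · exact AddSubgroup.subset_closure (Or.inl hS)
  · exact h2 _ hS

/-- **The Kummer subgroup of the cusp halves, fixedness form** — the data `𝒱`, `h𝒱fin`, `h𝒱` and the membership parts of `hKum`/`hodd` of
`StepTwo.propositionA_complex` from: every `2`-torsion point of `W₀(ℂ)` is fixed by `Aut(ℂ/ℚ)` (D1) and every Atkin–Lehner point
`R_y = π₀(c₀·{∞,1/y}_f)` (`N = Q·y` coprime) is fixed (D3); `R_y` is torsion by Manin–Drinfeld (§1).
[cite: SilvermanAEC2009, Prop. X.1.4 and proof of Thm. X.1.1] [cite: Manin1972, Cor. 3.6] -/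
theorem exists_kummerSubgroup_cuspHalves_of_fixed (D₀ : ModularParametrizationData W₀ N)
    (h2fix : ∀ P : (W₀.baseChange ℂ).toAffine.Point, 2 • P = 0 → ∀ σ : ℂ ≃ₐ[ℚ] ℂ,
      Affine.Point.map (W' := W₀) (σ : ℂ →ₐ[ℚ] ℂ) P = P)
    (hRfix : ∀ Q y : ℕ, Q * y = N → Nat.Coprime Q y → ∀ σ : ℂ ≃ₐ[ℚ] ℂ,
      Affine.Point.map (W' := W₀) (σ : ℂ →ₐ[ℚ] ℂ) (D₀.uniformize ((D₀.c : ℂ) * modularSymbol D₀.f (1 / (y : ℚ)))) =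
        D₀.uniformize ((D₀.c : ℂ) * modularSymbol D₀.f (1 / (y : ℚ)))) :
    ∃ 𝒱 : AddSubgroup ((ℂ ≃ₐ[ℚ] ℂ) → (W₀.baseChange ℂ).toAffine.Point),
      (𝒱 : Set ((ℂ ≃ₐ[ℚ] ℂ) → (W₀.baseChange ℂ).toAffine.Point)).Finite ∧ Nat.card 𝒱 ≤ 4 ∧
      (∀ Q y : ℕ, Q * y = N → Nat.Coprime Q y →
        (fun σ : ℂ ≃ₐ[ℚ] ℂ ↦
          Affine.Point.map (W' := W₀) (σ : ℂ →ₐ[ℚ] ℂ) (D₀.uniformize ((D₀.c : ℂ) * modularSymbol D₀.f (1 / (y : ℚ)) / 2)) -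
            D₀.uniformize ((D₀.c : ℂ) * modularSymbol D₀.f (1 / (y : ℚ)) / 2)) ∈ 𝒱) ∧
      (∀ S : (W₀.baseChange ℂ).toAffine.Point, 2 • (2 • S) = 0 →
        (fun σ : ℂ ≃ₐ[ℚ] ℂ ↦ Affine.Point.map (W' := W₀) (σ : ℂ →ₐ[ℚ] ℂ) S - S) ∈ 𝒱) := by
  classical
  have hN0 : N ≠ 0 := NeZero.ne N
  let R : ℕ → (W₀.baseChange ℂ).toAffine.Point := fun y ↦ D₀.uniformize ((D₀.c : ℂ) * modularSymbol D₀.f (1 / (y : ℚ)))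
  set F : Set (W₀.baseChange ℂ).toAffine.Point := {P | ∃ y : ℕ, y ∣ N ∧ Nat.Coprime (N / y) y ∧ P = R y} with hF
  have hFfin : F.Finite := by
    refine ((Set.finite_le_nat N).image R).subset ?_
    rintro P ⟨y, hy, -, rfl⟩
    exact ⟨y, Nat.le_of_dvd (Nat.pos_of_ne_zero hN0) hy, rfl⟩
  have hFfix : ∀ P ∈ F, ∀ σ : ℂ ≃ₐ[ℚ] ℂ, Affine.Point.map (W' := W₀) (σ : ℂ →ₐ[ℚ] ℂ) P = P := by
    rintro P ⟨y, hy, hcop, rfl⟩ σ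
    exact hRfix (N / y) y (Nat.div_mul_cancel hy) hcop σ
  have hFtor : ∀ P ∈ F, IsOfFinAddOrder P := by
    rintro P ⟨y, -, -, rfl⟩
    exact isOfFinAddOrder_uniformize_mul_modularSymbol D₀ _
  obtain ⟨𝒱, h𝒱fin, h𝒱card, h𝒱mem⟩ := exists_kummerSubgroup_of_fixed D₀ F hFfin hFfix hFtor h2fix
  refine ⟨𝒱, h𝒱fin, h𝒱card, fun Q y hQy hcop ↦ h𝒱mem _ (Or.inl ?_), fun S hS ↦ h𝒱mem S (Or.inr hS)⟩
  have hy : y ∣ N := ⟨Q, by rw [mul_comm]; exact hQy.symm⟩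
  have hy0 : y ≠ 0 := by rintro rfl; exact hN0 (by rw [← hQy, mul_zero])
  have hQ : N / y = Q := Nat.div_eq_of_eq_mul_left (Nat.pos_of_ne_zero hy0) hQy.symm
  refine ⟨y, hy, by rw [hQ]; exact hcop, ?_⟩
  rw [← map_nsmul]
  congr 1
  rw [nsmul_eq_mul]; push_cast; ring

end Summit.BirchSwinnertonDyer.BirchSwinnertonDyer.Theorems.ManinLocalTwoThree.KummerSubgroup

end
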